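import Summits.QuantumFields.YangMills.Theorems.BalabanUVNodesN08HaarCompatibilityGuardMonotonePairing

/-!
# BalabanUVNodes ∕ N08 — GLOBAL INJECTIVITY OF THE PRINTED exp-mean-log FIBRE MAP ON ITS GUARD SET BY A MONOTONE HEIGHT, FOR EVERY `Σcᵢ ≤ 1 − 1∕400`
# AT THE TYPED GUARD `δ₂ = 1∕3` — no sheet count (item 3, part 30C)

WIDTH SEAT `pub-ymgap-dag-n08-w3` g6, item-3 lineage (successor of part 26B p624810, whose smallness `(Σcᵢ)θ² < sin²θ` reached `Σcᵢ ≤ 24∕25`), 2026-08-28.  DAG node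
N08 = [Balaban1985UV3] Thm 1 p. 257 (compact) + Thm 2 p. 272; the typed (0.4) averaging and its guard = [Balaban1987RG1] (0.4) p. 253; key item K1⁷
`StabilityBAtRecordR13SepCoPH` (stmt-QuantumFields-20542, `aside`), `--supports … --as helper`.  COUNT-NEUTRAL.

THE MECHANISM ([folklore] Riemannian monotonicity; quaternion model of pub-balaban's `T4EMLFibreAC`).  If `k u = k u′` with `u′ = u eˣ` (`x = qlog(ū u′)` imaginary,
`D = ‖x‖ < 2θ`; the geodesic `u e^{tx}` stays in the guard by part 26A), the HEIGHT `F(t) = ⟪k(u e^{tx})·z̄, X⟫` (`z = k u`, `X = u x ū`) has `F 0 = F 1 = 0`.  Its derivative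
is `⟪m_t·q_t, X⟫` with `q_t = k(u e^{tx})·z̄` and `m_t = D exp(Y_t)(P_t X)·e^{−Y_t}` (part 27A `kD_apply_mul`;
★ `fderiv_exp_mul_exp_neg`: `D exp(Y)(M)·e^{−Y} = par_Y M + (sinc·cos)(‖Y‖)·perp_Y M + sinc²(‖Y‖)·(Y·perp_Y M)`), and
  `F′(t) ≥ ⟪m_t, X⟫ − ‖m_t‖·‖q_t − 1‖·‖X‖ ≥ c₁D² − tμ²D³`
(part 30B `inner_trivialised_ge` and `norm_N_sub_sum_N_le`, part 26A `‖D exp(Y)h‖ ≤ ‖h‖`, the drift `‖q_t − 1‖ ≤ tμD` by the mean-value inequality; `μ = λ′ + β`).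
The comparison `G(t) = F(t) − c₁D²t + μ²D³t²∕2` has `G′ ≥ 0` on `[0,1]`, and Lagrange's theorem gives `0 ≤ G 1 − G 0 = −(c₁ − μ²D∕2)D² < 0` once `θμ² < c₁`:
  ★★★ `injOn_kf_of_monotone` (general `0 < θ ≤ 3∕8`, `δ ≤ sin θ`, `β ≥ ψ(θ)`, numeric hypothesis `θ(λ′ + β)² < c₁`) · `ψ_slot_le` (`ψ(17∕50) ≤ 1∕24`) ·
  ★★★ `injOn_kf_slot400`: **at the typed guard `‖aᵢū − 1‖ < 1∕3` the fibre map is INJECTIVE ON THE WHOLE GUARD SET for every `Σcᵢ ≤ 1 − 1∕400`** ·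
  ★★ `injOn_expMeanLog_deltaSU_of_le`: the same in the `SU(2)` letters of part 26B ∕ pub-balaban's `haar_restrict_map_absolutelyContinuous_expMeanLog`.
CONSEQUENCE (part 31, separate file): part 29C's chain re-run with this injectivity ⇒ (H_K-core) ∕ (H_K) ∕ part 20's one-step bound at `N = 2` with EXPLICIT
`K = m⁻¹ + 1` on `L^{d−1} ≤ 400` (`L ≤ 20` at `d = 3`: the record's smallest admissible block sizes `8 ≤ L ≤ 20` get a closed number; every `L` with an
existential `K` is n08-w6 g5's `…GuardCoreLawSUN`).  HONEST: still a RANGE — conjecturally the height is monotone for every `λ′ > 0` (seat numerics: `min F′∕D² ≈ λ′a₀`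
down to `λ′ = 10⁻³`), NOT claimed; ONE RG step.

HONEST FRAMING.  [folklore] quaternion calculus over pub-balaban's `T4QuatExpLog` ∕ `T4EMLFibreAC` and n08-w6's `ψ` facts BY IMPORT; nothing of
Bałaban's asserted; E6′ NOT decided; the k-uniform `hmass` NOT supplied; count-neutral; N08 NOT discharged; counts unmoved (typed 28∕28 · discharged 5∕27); one
finite 𝕋⁴ programme at fixed ε — R4 closes the CONDITIONAL rung `BalabanLadder.UV` only; the Yang–Mills mass gap (Clay) is NOT proved by any of this; nothing
continuum ∕ OS.  0 `sorry`, 0 `def`, 0 `instance`, 0 `notation`, standard axioms.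
-/

noncomputable section

open NormedSpace Set Metric Function Filter
open scoped RealInnerProductSpace Topology Quaternion

namespace Summit.QuantumFields.YangMills.BalabanUVNodes.N08HaarCompatibilityGuardMonotoneInjective

open Literature.MathematicalPhysics.QuantumFieldTheory.Balaban1983to89
open Literature.MathematicalPhysics.QuantumFieldTheory.Balaban1983to89.T4QuatExpLog
open Literature.MathematicalPhysics.QuantumFieldTheory.Balaban1983to89.T4EMLFibreAC
open Summit.QuantumFields.YangMills.BalabanUVNodes.N08HaarCompatibilityGuardGeodesics
open Summit.QuantumFields.YangMills.BalabanUVNodes.N08HaarCompatibilityGuardCoreInjective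
open Summit.QuantumFields.YangMills.BalabanUVNodes.N08HaarCompatibilityGuardChartLift
open Summit.QuantumFields.YangMills.BalabanUVNodes.N08HaarCompatibilityGuardMonotoneDefect
open Summit.QuantumFields.YangMills.BalabanUVNodes.N08HaarCompatibilityGuardMonotonePairing
open Summit.QuantumFields.YangMills.BalabanUVNodes.N08HaarCompatibilityGuardJacobianContractionFrame (ψ_nonneg_of_abs_lt_pi)

/-! ## §1 The right-trivialised differential of `exp` and the height pairing -/

/-- **THE RIGHT-TRIVIALISED DIFFERENTIAL OF `exp` AT AN IMAGINARY QUATERNION**: for imaginary `Y` (`‖Y‖ < π`) and imaginary `M`,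
`D exp(Y)(M)·e^{−Y} = par_Y M + (sinc·cos)(‖Y‖)·perp_Y M + sinc²(‖Y‖)·(Y·perp_Y M)` — radially the identity, transversally the rotation by the angle
`‖Y‖` about `Y` scaled by `sinc ‖Y‖` (pub-balaban's `fderiv_exp_apply_of_commute` ∕ `…_of_inner_eq_zero`). [folklore] -/
theorem fderiv_exp_mul_exp_neg {Y M : ℍ} (hY : Y.re = 0) (hM : M.re = 0) :
    fderiv ℝ exp Y M * exp (-Y) =
      par Y M + (Real.sinc ‖Y‖ * Real.cos ‖Y‖) • perp Y M + Real.sinc ‖Y‖ ^ 2 • (Y * perp Y M) := by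
  rcases eq_or_ne Y 0 with rfl | hY0
  · rw [(hasFDerivAt_exp_zero (𝕂 := ℝ) (𝔸 := ℍ)).fderiv, neg_zero, NormedSpace.exp_zero, mul_one, par_zero_left, perp_zero_left,
      zero_mul, smul_zero, add_zero, zero_add, norm_zero, Real.sinc_zero, Real.cos_zero, one_mul, one_smul]
    rfl
  have hθ : 0 < ‖Y‖ := norm_pos_iff.2 hY0
  have hp_re : (perp Y M).re = 0 := perp_re hY hM
  have h1 : fderiv ℝ exp Y (par Y M) = par Y M * exp Y := fderiv_exp_apply_of_commute ((Commute.refl Y).smul_right _)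
  have h2 : fderiv ℝ exp Y (perp Y M) = Real.sinc ‖Y‖ • perp Y M := fderiv_exp_apply_of_inner_eq_zero hY hp_re (inner_perp Y M)
  have hexpneg : exp (-Y) = ((Real.cos ‖Y‖ : ℝ) : ℍ) - (Real.sin ‖Y‖ / ‖Y‖) • Y := by
    rw [Quaternion.exp_of_re_eq_zero (-Y) (by rw [Quaternion.re_neg, hY, neg_zero]), norm_neg, smul_neg, sub_eq_add_neg]
  have hanti : perp Y M * Y = -(Y * perp Y M) := by
    rw [mul_eq_neg_mul_of_inner_eq_zero hY hp_re (inner_perp Y M), neg_neg]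
  have hsinc : Real.sin ‖Y‖ / ‖Y‖ = Real.sinc ‖Y‖ := (Real.sinc_of_ne_zero hθ.ne').symm
  calc fderiv ℝ exp Y M * exp (-Y) = fderiv ℝ exp Y (par Y M + perp Y M) * exp (-Y) := by rw [par_add_perp]
    _ = par Y M * (exp Y * exp (-Y)) + Real.sinc ‖Y‖ • (perp Y M * exp (-Y)) := by
        rw [map_add, h1, h2, add_mul, mul_assoc, smul_mul_assoc]
    _ = par Y M + Real.sinc ‖Y‖ • (Real.cos ‖Y‖ • perp Y M + (Real.sin ‖Y‖ / ‖Y‖) • (Y * perp Y M)) := by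
        rw [exp_mul_exp_neg, mul_one, hexpneg, mul_sub, Quaternion.mul_coe_eq_smul, mul_smul_comm, hanti, smul_neg, sub_neg_eq_add]
    _ = par Y M + (Real.sinc ‖Y‖ * Real.cos ‖Y‖) • perp Y M + Real.sinc ‖Y‖ ^ 2 • (Y * perp Y M) := by
        rw [hsinc, smul_add, smul_smul, smul_smul, sq, add_assoc]

/-- The height pairing splits off the drift: `⟪m·q, X⟫ ≥ ⟪m, X⟫ − ‖m‖·‖q − 1‖·‖X‖`. [folklore] -/
theorem inner_mul_ge_sub (m q X : ℍ) : ⟪m, X⟫ - ‖m‖ * ‖q - 1‖ * ‖X‖ ≤ ⟪m * q, X⟫ := by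
  have h : m * q = m + m * (q - 1) := by rw [mul_sub, mul_one, add_sub_cancel]
  rw [h, inner_add_left]
  have h2 : |⟪m * (q - 1), X⟫| ≤ ‖m * (q - 1)‖ * ‖X‖ := abs_real_inner_le_norm _ _
  rw [norm_mul] at h2
  linarith [neg_abs_le ⟪m * (q - 1), X⟫]

/-! ## §2 Global injectivity of the fibre map on its guard set by the monotone height -/

section Fibre

variable {ι : Type*} [Fintype ι]

/-- ★★★ **GLOBAL INJECTIVITY OF THE PRINTED exp-mean-log FIBRE MAP ON ITS GUARD SET BY A MONOTONE HEIGHT (no sheet count).**  Unit `aᵢ`,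
weights `cᵢ ≥ 0` with `Σcᵢ ≤ 1`, an angle `0 < θ ≤ 3∕8`, a chord `δ ≤ sin θ`, any `β ≥ ψ(θ)`, and the NUMERIC HYPOTHESIS
`θ·(λ′ + β)² < c₁ := λ′a₀ − β((1 − a₀)² + θ²)∕(4a₀)` (`λ′ = 1 − Σcᵢ`, `a₀ = (1 − θ²∕6)(1 − θ²∕2)`): the fibre map `k(u) = exp(Σᵢ cᵢ qlog(aᵢū))·u`
is INJECTIVE on `{u : ‖u‖ = 1, ∀ i ‖aᵢū − 1‖ < δ}`.  MECHANISM: if `k u = k u′`, `u′ = u eˣ` (`x = qlog(ū u′)`, `D = ‖x‖ < 2θ`, the geodesic `u e^{tx}`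
stays in the guard by part 26A), the height `F(t) = ⟪k(u e^{tx})·k(u)⁻¹, X⟫` (`X = u x ū`) has `F 0 = F 1 = 0`; its derivative is `⟪m_t q_t, X⟫` with
`m_t = D exp(Y_t)(P_t X)·e^{−Y_t}` (part 27A `kD_apply_mul` + §1) and `q_t = k(u e^{tx})·k(u)⁻¹`, `‖q_t − 1‖ ≤ tμD` (`μ = λ′ + β`, part 30B
`norm_N_sub_sum_N_le` + part 26A `‖D exp(Y)h‖ ≤ ‖h‖`), so `F′(t) ≥ c₁D² − tμ²D³` (part 30B `inner_trivialised_ge` + `inner_mul_ge_sub`); the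
comparison `G(t) = F(t) − c₁D²t + μ²D³t²∕2` has `G′ ≥ 0`, and Lagrange's mean value theorem gives `0 ≤ G 1 − G 0 = −(c₁ − μ²D∕2)D² < 0`.
[cite: Balaban1987RG1, (0.4) p.253 (the averaging; bookkeeping — nothing of print asserted)] -/
theorem injOn_kf_of_monotone {a : ι → ℍ} {c : ι → ℝ} (ha : ∀ i, ‖a i‖ = 1) (hc : ∀ i, 0 ≤ c i) (hs1 : ∑ i, c i ≤ 1)
    {δ θ : ℝ} (hθ0 : 0 < θ) (hθ : θ ≤ 3 / 8) (hδθ : δ ≤ Real.sin θ) {β : ℝ} (hβ : ψ θ ≤ β)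
    (hnum : θ * (1 - ∑ i, c i + β) ^ 2 <
      (1 - ∑ i, c i) * ((1 - θ ^ 2 / 6) * (1 - θ ^ 2 / 2)) -
        β * ((1 - (1 - θ ^ 2 / 6) * (1 - θ ^ 2 / 2)) ^ 2 + θ ^ 2) / (4 * ((1 - θ ^ 2 / 6) * (1 - θ ^ 2 / 2)))) :
    InjOn (kf a c) {u : ℍ | ‖u‖ = 1 ∧ ∀ i, ‖a i * star u - 1‖ < δ} := by
  intro u hu u' hu' heq
  rcases hu with ⟨hu1, hug⟩
  rcases hu' with ⟨hu1', hug'⟩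
  -- constants
  set s : ℝ := ∑ i, c i with hs_def
  set c₁ : ℝ := (1 - s) * ((1 - θ ^ 2 / 6) * (1 - θ ^ 2 / 2)) -
      β * ((1 - (1 - θ ^ 2 / 6) * (1 - θ ^ 2 / 2)) ^ 2 + θ ^ 2) / (4 * ((1 - θ ^ 2 / 6) * (1 - θ ^ 2 / 2))) with hc₁_def
  set μ : ℝ := 1 - s + β with hμ_def
  have hθπ : θ < Real.pi := by linarith [Real.pi_gt_three]
  have hθ1 : θ ≤ 1 := by linarith
  have hsinθ : 0 < Real.sin θ := Real.sin_pos_of_pos_of_lt_pi hθ0 hθπ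
  have hδθ' : δ ≤ θ := hδθ.trans (Real.sin_le hθ0.le)
  have hψθ : 0 ≤ ψ θ := ψ_nonneg_of_abs_lt_pi (by rwa [abs_of_nonneg hθ0.le])
  have hμ0 : 0 ≤ μ := by rw [hμ_def]; linarith [hψθ.trans hβ]
  -- empty index set: the map is the identity
  rcases isEmpty_or_nonempty ι with hι | ⟨⟨i₀⟩⟩
  · have hY : ∀ w, Yf a c w = 0 := fun w => by simp [Yf]
    simpa [kf, hY] using heq
  -- unit algebra
  have hus : u * star u = 1 := by rw [Quaternion.self_mul_star, Quaternion.normSq_eq_norm_mul_self, hu1]; simp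
  have hsu : star u * u = 1 := by rw [Quaternion.star_mul_self, Quaternion.normSq_eq_norm_mul_self, hu1]; simp
  have hg : ∀ i, ‖a i - u‖ < δ := fun i => by rw [← norm_mul_star_sub_one hu1]; exact hug i
  have hg' : ∀ i, ‖a i - u'‖ < δ := fun i => by rw [← norm_mul_star_sub_one hu1']; exact hug' i
  have hδ0 : 0 < δ := (norm_nonneg _).trans_lt (hg i₀)
  -- the relative position `v = ū u′` and its logarithm `x`
  set v := star u * u' with hv_def
  have hv1 : ‖v‖ = 1 := by rw [hv_def, norm_mul, Quaternion.norm_star, hu1, hu1', one_mul]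
  have hvsub : ‖v - 1‖ = ‖u' - u‖ := by
    rw [hv_def, show star u * u' - 1 = star u * (u' - u) by rw [mul_sub, hsu], norm_mul, Quaternion.norm_star, hu1, one_mul]
  have huu' : ‖u' - u‖ < 2 * δ := by
    calc ‖u' - u‖ = ‖(a i₀ - u) - (a i₀ - u')‖ := by congr 1; abel
      _ ≤ ‖a i₀ - u‖ + ‖a i₀ - u'‖ := norm_sub_le _ _
      _ < δ + δ := add_lt_add (hg i₀) (hg' i₀)
      _ = 2 * δ := by ring
  have hv34 : ‖v - 1‖ ≤ 3 / 4 := by rw [hvsub]; linarith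
  have hv1' : ‖v - 1‖ < 1 := by linarith
  set x := qlog v with hx_def
  have hx : x.re = 0 := qlog_re_of_norm_eq_one hv1 hv1'
  have hexpx : exp x = v := exp_qlog hv1'
  obtain ⟨-, hchord⟩ := norm_sub_one_eq_two_mul_sin hv1 hv34
  have hxπ : ‖x‖ < Real.pi := by
    have := (norm_qlog_le hv1').trans_lt (show ‖v - 1‖ / (1 - ‖v - 1‖) < Real.pi by
      rw [div_lt_iff₀ (by linarith)]; nlinarith [Real.pi_gt_three])
    exact this
  -- `D/2 < θ`
  have hdθ : ‖x‖ / 2 < θ := by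
    by_contra hle
    have hle : θ ≤ ‖x‖ / 2 := not_lt.1 hle
    have h3 : ‖x‖ ≤ 3 := by
      have := norm_qlog_le hv1'
      have h4 : ‖v - 1‖ / (1 - ‖v - 1‖) ≤ 3 := by rw [div_le_iff₀ (by linarith)]; linarith
      exact this.trans h4
    have h1 : Real.sin θ ≤ Real.sin (‖x‖ / 2) :=
      Real.sin_le_sin_of_le_of_le_pi_div_two (by linarith) (by linarith [Real.pi_gt_three]) hle
    linarith
  -- the geodesic from `u` to `u′` stays in the guard
  have hend : u * exp x = u' := by rw [hexpx, hv_def, ← mul_assoc, hus, one_mul]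
  have hpath : ∀ t ∈ Icc (0 : ℝ) 1, ∀ i, ‖a i - u * exp (t • x)‖ < δ := fun t ht i =>
    norm_sub_mul_exp_smul_lt (ha i) hu1 hx hxπ (by linarith) (hg i) (by rw [hend]; exact hg' i) ht.1 ht.2
  -- it suffices to show `x = 0`
  by_contra hne
  have hx0 : x ≠ 0 := by
    intro hx0; apply hne; rw [← hend, hx0, NormedSpace.exp_zero, mul_one]
  have hD : 0 < ‖x‖ := norm_pos_iff.2 hx0
  -- the path, the direction `X = u x ū`, the base point `z = k u`
  have hγ1 : ∀ t : ℝ, ‖u * exp (t • x)‖ = 1 := fun t => by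
    rw [norm_mul, hu1, norm_exp_of_re_eq_zero (by simp [hx]), one_mul]
  have hgd : ∀ t ∈ Icc (0 : ℝ) 1, ∀ i, ‖a i * star (u * exp (t • x)) - 1‖ < δ := fun t ht i => by
    rw [norm_mul_star_sub_one (hγ1 t)]; exact hpath t ht i
  have hgd2 : ∀ t ∈ Icc (0 : ℝ) 1, ∀ i, ‖a i * star (u * exp (t • x)) - 1‖ < 1 / 2 := fun t ht i =>
    (hgd t ht i).trans_le (by linarith)
  set X : ℍ := u * x * star u with hX_def
  have hXre : X.re = 0 := re_mul_mul_star u hx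
  have hXn : ‖X‖ = ‖x‖ := by rw [hX_def, norm_mul, norm_mul, Quaternion.norm_star, hu1, one_mul, mul_one]
  have hconj : ∀ t : ℝ, u * exp (t • x) * x * star (u * exp (t • x)) = X := by
    intro t
    have hcomm : exp (t • x) * x = x * exp (t • x) := (((Commute.refl x).smul_left t).exp_left).eq
    have he : exp (t • x) * star (exp (t • x)) = 1 := by
      rw [Quaternion.self_mul_star, Quaternion.normSq_eq_norm_mul_self, norm_exp_of_re_eq_zero (by simp [hx])]; simp
    calc u * exp (t • x) * x * star (u * exp (t • x)) = u * (exp (t • x) * x) * (star (exp (t • x)) * star u) := by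
          rw [star_mul]; simp only [mul_assoc]
      _ = u * x * (exp (t • x) * star (exp (t • x))) * star u := by rw [hcomm]; simp only [mul_assoc]
      _ = X := by rw [he, mul_one]
  set z : ℍ := kf a c u with hz_def
  have hYre0 : (Yf a c u).re = 0 := Yf_re_eq_zero c hu1 ha hc hs1 fun i => (hug i).trans_le (by linarith)
  have hz1 : ‖z‖ = 1 := by rw [hz_def, kf, norm_mul, norm_exp_of_re_eq_zero hYre0, hu1, mul_one]
  have hzz : z * star z = 1 := by rw [Quaternion.self_mul_star, Quaternion.normSq_eq_norm_mul_self, hz1]; simp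
  -- the letters at the path point `w_t = u e^{tx}`
  have hW1 : ∀ (t : ℝ) (i : ι), ‖a i * star (u * exp (t • x))‖ = 1 := fun t i => by
    rw [norm_mul, Quaternion.norm_star, ha i, hγ1 t, one_mul]
  have hZre : ∀ t ∈ Icc (0 : ℝ) 1, ∀ i, (qlog (a i * star (u * exp (t • x)))).re = 0 := fun t ht i =>
    qlog_re_of_norm_eq_one (hW1 t i) ((hgd2 t ht i).trans (by norm_num))
  have hZθ : ∀ t ∈ Icc (0 : ℝ) 1, ∀ i, ‖qlog (a i * star (u * exp (t • x)))‖ ≤ θ := fun t ht i =>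
    (norm_qlog_lt_of_chord (hW1 t i) (hgd t ht i) hδθ hθ0 hθ).le
  have hYre : ∀ t ∈ Icc (0 : ℝ) 1, (Yf a c (u * exp (t • x))).re = 0 := fun t ht =>
    Yf_re_eq_zero c (hγ1 t) ha hc hs1 (hgd2 t ht)
  -- the tangent: `k′(w_t)(w_t x)·z̄ = m_t·q_t`
  have hkD : ∀ t ∈ Icc (0 : ℝ) 1, kD a c (u * exp (t • x)) (u * exp (t • x) * x) * star z =
      (fderiv ℝ exp (Yf a c (u * exp (t • x)))
          (N (Yf a c (u * exp (t • x))) X - ∑ i, c i • N (qlog (a i * star (u * exp (t • x)))) X) *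
        exp (-Yf a c (u * exp (t • x)))) * (kf a c (u * exp (t • x)) * star z) := by
    intro t ht
    rw [kD_apply_mul c (hγ1 t) ha hc hs1 (hgd2 t ht) hx, hconj t, kf]
    simp only [mul_assoc]
    rw [← mul_assoc (exp (-Yf a c (u * exp (t • x)))) (exp (Yf a c (u * exp (t • x)))), exp_neg_mul_exp, one_mul]
  -- the bounds along the path
  have hM : ∀ t ∈ Icc (0 : ℝ) 1,
      ‖N (Yf a c (u * exp (t • x))) X - ∑ i, c i • N (qlog (a i * star (u * exp (t • x)))) X‖ ≤ μ * ‖x‖ := by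
    intro t ht
    rw [← hXn, hμ_def, hs_def, Yf]
    exact norm_N_sub_sum_N_le (hZre t ht) hc hs1 hθ0 hθ1 (hZθ t ht) hβ hXre
  have hspeed : ∀ t ∈ Icc (0 : ℝ) 1, ‖kD a c (u * exp (t • x)) (u * exp (t • x) * x)‖ ≤ μ * ‖x‖ := by
    intro t ht
    rw [kD_apply_mul c (hγ1 t) ha hc hs1 (hgd2 t ht) hx, hconj t, norm_mul, hγ1 t, mul_one]
    have hMre : (N (Yf a c (u * exp (t • x))) X - ∑ i, c i • N (qlog (a i * star (u * exp (t • x)))) X).re = 0 := by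
      rw [Yf, N_sub_sum_N_eq (hZre t ht) c X, ← Yf, Quaternion.re_add, Quaternion.re_smul, hXre, smul_zero, zero_add]
      exact defect_re (hZre t ht) c (hYre t ht) hXre
    exact (norm_fderiv_exp_apply_le (hYre t ht) hMre).trans (hM t ht)
  -- derivative of the path of images
  have hderk : ∀ t ∈ Icc (0 : ℝ) 1, HasDerivAt (fun r : ℝ => kf a c (u * exp (r • x)))
      (kD a c (u * exp (t • x)) (u * exp (t • x) * x)) t := by
    intro t ht
    have hγ : HasDerivAt (fun r : ℝ => u * exp (r • x)) (u * exp (t • x) * x) t := by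
      have h := (hasDerivAt_exp_smul_const (𝕂 := ℝ) x t).const_mul u
      simpa [mul_assoc] using h
    exact (hasStrictFDerivAt_kf c fun i => (hgd2 t ht i).trans (by norm_num)).hasFDerivAt.comp_hasDerivAt t hγ
  -- the drift `‖q_t − 1‖ ≤ tμD`
  have hdrift : ∀ t ∈ Icc (0 : ℝ) 1, ‖kf a c (u * exp (t • x)) * star z - 1‖ ≤ μ * ‖x‖ * t := by
    intro t ht
    have h := norm_image_sub_le_of_norm_deriv_le_segment' (f := fun r : ℝ => kf a c (u * exp (r • x))) (a := 0) (b := 1)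
      (fun r hr => (hderk r hr).hasDerivWithinAt) (fun r hr => hspeed r (Ico_subset_Icc_self hr)) t ht
    simp only [zero_smul, NormedSpace.exp_zero, mul_one, sub_zero] at h
    rw [← hz_def] at h
    calc ‖kf a c (u * exp (t • x)) * star z - 1‖ = ‖(kf a c (u * exp (t • x)) - z) * star z‖ := by rw [sub_mul, hzz]
      _ = ‖kf a c (u * exp (t • x)) - z‖ := by rw [norm_mul, Quaternion.norm_star, hz1, mul_one]
      _ ≤ μ * ‖x‖ * t := h
  -- the height and its derivative
  set F : ℝ → ℝ := fun t => ⟪kf a c (u * exp (t • x)) * star z, X⟫ with hF_def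
  set F' : ℝ → ℝ := fun t => ⟪kD a c (u * exp (t • x)) (u * exp (t • x) * x) * star z, X⟫ with hF'_def
  have hderF : ∀ t ∈ Icc (0 : ℝ) 1, HasDerivAt F (F' t) t := by
    intro t ht
    have h := ((hderk t ht).mul_const (star z)).inner ℝ (hasDerivAt_const t X)
    simpa [hF_def, hF'_def] using h
  have hF0 : F 0 = 0 := by
    simp only [hF_def, zero_smul, NormedSpace.exp_zero, mul_one]
    rw [← hz_def, hzz, real_inner_comm, ← Quaternion.coe_one, inner_coe_right_of_re hXre]
  have hF1 : F 1 = 0 := by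
    simp only [hF_def, one_smul]
    rw [hend, ← heq, hzz, real_inner_comm, ← Quaternion.coe_one, inner_coe_right_of_re hXre]
  -- the derivative lower bound
  have hF'ge : ∀ t ∈ Icc (0 : ℝ) 1, c₁ * ‖x‖ ^ 2 - μ ^ 2 * ‖x‖ ^ 3 * t ≤ F' t := by
    intro t ht
    have hpair := inner_trivialised_ge (hZre t ht) hc hs1 hθ0 hθ1 (hZθ t ht) hβ hXre (Y := Yf a c (u * exp (t • x)))
      (M := N (Yf a c (u * exp (t • x))) X - ∑ i, c i • N (qlog (a i * star (u * exp (t • x)))) X) (by rw [Yf]) rfl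
    have hMre : (N (Yf a c (u * exp (t • x))) X - ∑ i, c i • N (qlog (a i * star (u * exp (t • x)))) X).re = 0 := by
      rw [Yf, N_sub_sum_N_eq (hZre t ht) c X, ← Yf, Quaternion.re_add, Quaternion.re_smul, hXre, smul_zero, zero_add]
      exact defect_re (hZre t ht) c (hYre t ht) hXre
    have hm := fderiv_exp_mul_exp_neg (hYre t ht) hMre
    have hmn : ‖fderiv ℝ exp (Yf a c (u * exp (t • x)))
          (N (Yf a c (u * exp (t • x))) X - ∑ i, c i • N (qlog (a i * star (u * exp (t • x)))) X) *
        exp (-Yf a c (u * exp (t • x)))‖ ≤ μ * ‖x‖ := by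
      rw [norm_mul, norm_exp_of_re_eq_zero (by rw [Quaternion.re_neg, hYre t ht, neg_zero]), mul_one]
      exact (norm_fderiv_exp_apply_le (hYre t ht) hMre).trans (hM t ht)
    have hsplit := inner_mul_ge_sub
      (fderiv ℝ exp (Yf a c (u * exp (t • x)))
          (N (Yf a c (u * exp (t • x))) X - ∑ i, c i • N (qlog (a i * star (u * exp (t • x)))) X) *
        exp (-Yf a c (u * exp (t • x))))
      (kf a c (u * exp (t • x)) * star z) X
    rw [← hkD t ht] at hsplit
    rw [hm] at hsplit hmn
    rw [← hs_def, ← hc₁_def, hXn] at hpair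
    have hprod : ‖par (Yf a c (u * exp (t • x))) (N (Yf a c (u * exp (t • x))) X - ∑ i, c i • N (qlog (a i * star (u * exp (t • x)))) X) +
        (Real.sinc ‖Yf a c (u * exp (t • x))‖ * Real.cos ‖Yf a c (u * exp (t • x))‖) •
          perp (Yf a c (u * exp (t • x))) (N (Yf a c (u * exp (t • x))) X - ∑ i, c i • N (qlog (a i * star (u * exp (t • x)))) X) +
        Real.sinc ‖Yf a c (u * exp (t • x))‖ ^ 2 •
          (Yf a c (u * exp (t • x)) * perp (Yf a c (u * exp (t • x))) (N (Yf a c (u * exp (t • x))) X - ∑ i, c i • N (qlog (a i * star (u * exp (t • x)))) X))‖ *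
        ‖kf a c (u * exp (t • x)) * star z - 1‖ * ‖X‖ ≤ μ * ‖x‖ * (μ * ‖x‖ * t) * ‖x‖ := by
      rw [hXn]
      exact mul_le_mul_of_nonneg_right (mul_le_mul hmn (hdrift t ht) (norm_nonneg _) (mul_nonneg hμ0 (norm_nonneg _)))
        (norm_nonneg _)
    have hring : μ * ‖x‖ * (μ * ‖x‖ * t) * ‖x‖ = μ ^ 2 * ‖x‖ ^ 3 * t := by ring
    rw [hring] at hprod
    have : F' t = ⟪kD a c (u * exp (t • x)) (u * exp (t • x) * x) * star z, X⟫ := rfl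
    rw [this]
    linarith only [hsplit, hpair, hprod]
  -- the comparison function and Lagrange's mean value theorem
  set G : ℝ → ℝ := fun t => F t - (c₁ * ‖x‖ ^ 2 * t - μ ^ 2 * ‖x‖ ^ 3 / 2 * (t * t)) with hG_def
  have hderG : ∀ t ∈ Icc (0 : ℝ) 1, HasDerivAt G (F' t - (c₁ * ‖x‖ ^ 2 - μ ^ 2 * ‖x‖ ^ 3 * t)) t := by
    intro t ht
    have h2 : HasDerivAt (fun r : ℝ => c₁ * ‖x‖ ^ 2 * r - μ ^ 2 * ‖x‖ ^ 3 / 2 * (r * r)) (c₁ * ‖x‖ ^ 2 - μ ^ 2 * ‖x‖ ^ 3 * t) t :=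
      (((hasDerivAt_id' t).const_mul (c₁ * ‖x‖ ^ 2)).sub
        (((hasDerivAt_id' t).mul (hasDerivAt_id' t)).const_mul (μ ^ 2 * ‖x‖ ^ 3 / 2))).congr_deriv (by ring)
    exact (hderF t ht).sub h2
  have hGcont : ContinuousOn G (Icc 0 1) := fun t ht => (hderG t ht).continuousAt.continuousWithinAt
  obtain ⟨ξ, hξ, hξeq⟩ := exists_hasDerivAt_eq_slope G (fun t => F' t - (c₁ * ‖x‖ ^ 2 - μ ^ 2 * ‖x‖ ^ 3 * t)) (by norm_num)
    hGcont (fun t ht => hderG t (Ioo_subset_Icc_self ht))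
  have hξ' : ξ ∈ Icc (0 : ℝ) 1 := Ioo_subset_Icc_self hξ
  have hG01 : G 1 - G 0 = -(c₁ * ‖x‖ ^ 2 - μ ^ 2 * ‖x‖ ^ 3 / 2) := by
    simp only [hG_def, hF0, hF1]; ring
  rw [hG01, sub_zero, div_one] at hξeq
  have hpos : 0 < c₁ * ‖x‖ ^ 2 - μ ^ 2 * ‖x‖ ^ 3 / 2 := by
    have h1 : μ ^ 2 * (‖x‖ / 2) ≤ μ ^ 2 * θ := mul_le_mul_of_nonneg_left hdθ.le (sq_nonneg μ)
    have h2 : θ * μ ^ 2 < c₁ := by rw [hμ_def, hc₁_def, hs_def]; exact hnum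
    have h3 : 0 < c₁ - μ ^ 2 * (‖x‖ / 2) := by linarith only [h1, h2]
    have h4 : c₁ * ‖x‖ ^ 2 - μ ^ 2 * ‖x‖ ^ 3 / 2 = (c₁ - μ ^ 2 * (‖x‖ / 2)) * ‖x‖ ^ 2 := by ring
    rw [h4]; positivity
  have hge := hF'ge ξ hξ'
  linarith only [hge, hξeq, hpos]

/-- `ψ(17∕50) ≤ 1∕24`: `(23∕24)·sin(17∕50) ≤ (17∕50)·cos(17∕50)` from Mathlib's `sin_bound` and `1 − x²∕2 ≤ cos x`. [folklore] -/
theorem ψ_slot_le : ψ (17 / 50) ≤ 1 / 24 := by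
  have hθ : (17 / 50 : ℝ) ≠ 0 := by norm_num
  rw [ψ_of_ne_zero hθ]
  have hs := Real.sin_bound (show |(17 / 50 : ℝ)| ≤ 1 by rw [abs_of_pos (by norm_num)]; norm_num)
  have hc : 1 - (17 / 50 : ℝ) ^ 2 / 2 ≤ Real.cos (17 / 50) := Real.one_sub_sq_div_two_le_cos
  have hsin_pos : 0 < Real.sin (17 / 50) := Real.sin_pos_of_pos_of_lt_pi (by norm_num) (by linarith [Real.pi_gt_three])
  have hsin_le : Real.sin (17 / 50) ≤ 17 / 50 - (17 / 50) ^ 3 / 6 + (17 / 50) ^ 4 * (5 / 96) := by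
    have h1 := (abs_le.1 hs).2
    rw [abs_of_pos (by norm_num : (0 : ℝ) < 17 / 50)] at h1
    linarith
  rw [sub_le_comm, le_div_iff₀ hsin_pos]
  linarith

/-- ★★★ **THE [B10] SLOT: INJECTIVITY FOR EVERY `Σcᵢ ≤ 1 − 1∕400` AT THE TYPED GUARD `δ₂ = 1∕3`** (`N = 2`; the printed weights `cᵢ = 1∕#Idx` over the
non-central indices of a coarse bond have `Σcᵢ = 1 − L^{1−d}`, so this is EVERY block size with `L^{d−1} ≤ 400`, i.e. `L ≤ 20` at `d = 3` — part 26B reached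
`Σcᵢ ≤ 24∕25`, i.e. `L ∈ {3, 5}`): with `θ = 17∕50` (`1∕3 ≤ sin θ`), `β = 1∕24 ≥ ψ(θ)`, the numeric hypothesis of `injOn_kf_of_monotone` holds on the whole
range `1∕400 ≤ 1 − Σcᵢ ≤ 1`. [cite: Balaban1985UV3, p.260 (the SU(2) slot; bookkeeping)] -/
theorem injOn_kf_slot400 {a : ι → ℍ} {c : ι → ℝ} (ha : ∀ i, ‖a i‖ = 1) (hc : ∀ i, 0 ≤ c i) (hs : ∑ i, c i ≤ 1 - 1 / 400) :
    InjOn (kf a c) {u : ℍ | ‖u‖ = 1 ∧ ∀ i, ‖a i * star u - 1‖ < 1 / 3} := by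
  have hsin : (17 / 50 : ℝ) - (17 / 50) ^ 3 / 6 < Real.sin (17 / 50) := Real.sin_gt_sub_cube (by norm_num)
  have h13 : (1 / 3 : ℝ) ≤ Real.sin (17 / 50) := by linarith
  have hs0 : 0 ≤ ∑ i, c i := Finset.sum_nonneg fun i _ => hc i
  refine injOn_kf_of_monotone ha hc (by linarith) (by norm_num) (by norm_num) h13 ψ_slot_le ?_
  nlinarith [mul_nonneg (sub_nonneg.2 hs) hs0]

end Fibre

/-! ## §3 The corollary on `SU(2)` in the letters of pub-balaban's fibre normal form -/

section SU2

open scoped Matrix.Norms.L2Operator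

open Literature.MathematicalPhysics.QuantumLattice (quatMatrix su2Quat norm_su2Quat quatToSU2 quatToSU2_su2Quat)

variable {ι : Type*} [Fintype ι]

/-- ★★ **INJECTIVITY OF THE GUARDED exp-mean-log FIBRE LAW ON `SU(2)` AT THE TYPED GUARD, FOR EVERY `Σcᵢ ≤ 1 − 1∕400`** (the letters of
`T4EMLFibreAC.haar_restrict_map_absolutelyContinuous_expMeanLog` and of part 26B's `injOn_expMeanLog_deltaSU`, whose range was `Σcᵢ ≤ 8∕9`):
`hᵢ ∈ SU(2)`, `cᵢ ≥ 0`, guard `‖hᵢW* − 1‖ < δ₂ = deltaSU (Fin 2)` on `S`, `↑(K W) = exp(Σᵢ(cᵢ:ℂ)•mlog(hᵢW*))·W` on `S` ⇒ `K` injective on `S` — NO sheet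
count on this range. [cite: Balaban1985UV3, p.260 (SU(2) slot; bookkeeping)] -/
theorem injOn_expMeanLog_deltaSU_of_le {S : Set (Matrix.specialUnitaryGroup (Fin 2) ℂ)} (h : ι → Matrix.specialUnitaryGroup (Fin 2) ℂ)
    {c : ι → ℝ} (hc : ∀ i, 0 ≤ c i) (hs : ∑ i, c i ≤ 1 - 1 / 400)
    {K : Matrix.specialUnitaryGroup (Fin 2) ℂ → Matrix.specialUnitaryGroup (Fin 2) ℂ}
    (hg : ∀ W ∈ S, ∀ i, ‖(h i : Matrix (Fin 2) (Fin 2) ℂ) * star (W : Matrix (Fin 2) (Fin 2) ℂ) - 1‖ < ExpMeanLog.deltaSU (Fin 2))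
    (hKW : ∀ W ∈ S, (K W : Matrix (Fin 2) (Fin 2) ℂ) =
      NormedSpace.exp (∑ i, (c i : ℂ) • MatrixLog.mlog ((h i : Matrix (Fin 2) (Fin 2) ℂ) * star (W : Matrix (Fin 2) (Fin 2) ℂ)))
        * (W : Matrix (Fin 2) (Fin 2) ℂ)) :
    InjOn K S := by
  set a : ι → ℍ := fun i => su2Quat (h i) with ha_def
  have ha : ∀ i, ‖a i‖ = 1 := fun i => norm_su2Quat (h i)
  have hgq : ∀ W ∈ S, ∀ i, ‖a i * star (su2Quat W) - 1‖ < 1 / 3 := fun W hW i => by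
    rw [ha_def, ← norm_quatMatrix_sub_one, ← coe_mul_star_coe_eq_quatMatrix]
    exact ExpMeanLog.lt_third_of_lt_deltaSU (hg W hW i)
  have hk : ∀ W ∈ S, kf a c (su2Quat W) = su2Quat (K W) := fun W hW =>
    kf_su2Quat_eq h c (fun i => (ExpMeanLog.lt_third_of_lt_deltaSU (hg W hW i)).trans (by norm_num)) (hKW W hW)
  intro W hW W' hW' hKK
  have hq : su2Quat W = su2Quat W' :=
    injOn_kf_slot400 ha hc hs ⟨norm_su2Quat W, hgq W hW⟩ ⟨norm_su2Quat W', hgq W' hW'⟩ (by rw [hk W hW, hk W' hW', hKK])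
  rw [← quatToSU2_su2Quat W, hq, quatToSU2_su2Quat]

end SU2

end Summit.QuantumFields.YangMills.BalabanUVNodes.N08HaarCompatibilityGuardMonotoneInjective

end
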